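import Summits.ResolutionOfSingularities.ResolutionOfSingularities.Theorems.HilbertSamuelEliminationCampaignW42NearChain
import Summits.ResolutionOfSingularities.ResolutionOfSingularities.Theorems.HilbertSamuelEliminationCampaignW42TertiaryCorridor3
import HarnessLib

/-!
# [OURS · L1 W4.2] `NearChainTermination p` (the O2-type statement at arbitrary maximal strata) implies the isolated-origin
# statements, the `ν`-modifications of all maximal strata in characteristic `p`, and — for all primes, with CJS Thm. 1.2
# — the crux `SigmaMaxModificationsCorridor3` (stmt-ResolutionOfSingularities-19249)
# (`--supports stmt-ResolutionOfSingularities-17846`)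

OURS (slot W4.2 of cell res-hironaka, LADDER-RESOLUTION rung L, D-0089; prover seat res-L1-s42-pv-2, gen 2); NOT
statements of H. Hironaka's manuscript [Hironaka2017]; nothing of the manuscript is used or asserted. AI review is
weaker than expert review. Pure PROOF file over the OURS statement files `…CampaignW42Tertiary.lean` (p474474) and
`…CampaignW42NearChain.lean`.

* `IsIsolatedOrigin.isMaximalOrigin`; `tertiaryTerminationAt_of_nearChainTerminationAt`,
  `tertiaryTermination_of_nearChainTermination` — the arbitrary-stratum statements imply the isolated-origin ones
  (OURS-DESK #39); `nearChainTerminationAt_of_nearChainTermination` (ungraded ⇒ graded).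
* `nuMod_of_nearChainTermination` — `NearChainTermination p` + the oracle's answers on the strata ⇒
  `TameWild.NuMod X N d ν` for every reduced separated `X` of finite type over a field of characteristic `p`, every
  maximal `ν ≠ Φ^{(N)}`, ANY dimension (GeneralStrata file `nuMod_of_forall_noNearChain`, p486671).
* `nuMod_threefold_of_nearChainTermination` — in dimension `≤ 3` the answers come from CJS Thm. 1.2
  (`CossartJannsenSaito2020SequencePermissible`, named fact) through the choice oracle (Threefolds file).
* `hsBody_dim_le_three_of_nearChainTermination`, `sigmaMaxModificationsCorridor3_of_nearChainTermination` —
  `(∀ p prime, NearChainTermination p)` + CJS Thm. 1.2 ⇒ the crux body on `{dim ≤ 3}` and THE ROUTE DECL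
  `SigmaMaxModificationsCorridor3` by name (conditional; credits nothing: the typed open item `NearChainTermination p`
  and the undischarged named fact are its hypotheses).

## References

* V. Cossart, U. Jannsen, S. Saito, LNM 2270 (2020), Thm. 1.2, Def. 6.14/6.15, Rem. 6.29 (1), p. 98 Step 9, p. 107.
  [CossartJannsenSaito2020]
-/

noncomputable section

set_option linter.dupNamespace false -- mandated namespace of this single-conjunct summit

open CategoryTheory AlgebraicGeometry TopologicalSpace Topology IsLocalRing

namespace Summit.ResolutionOfSingularities.ResolutionOfSingularities.Theorems

namespace CampaignW42

open Literature.AlgebraicGeometry.Resolution Literature.RingTheory.HilbertSamuel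
open Summit.ResolutionOfSingularities.ResolutionOfSingularities.Theses.HilbertSamuelElimination
open Summit.ResolutionOfSingularities.ResolutionOfSingularities.Theorems.SigmaMaxModificationsCorridor3

universe u

variable {p : ℕ} {R : ∀ S : Scheme.{u}, CentreSeq S → Prop} {N : ℕ} {ν : ℕ → ℕ}

/-! ## Arbitrary strata ⇒ isolated origins -/

/-- An isolated origin is a maximal origin. [folklore] -/
theorem IsIsolatedOrigin.isMaximalOrigin {X : Scheme.{u}} {x : X} (hX : IsIsolatedOrigin p N ν X x) :
    IsMaximalOrigin p N ν X x :=
  ⟨hX.exists_structure, hX.isReduced, hX.dim_le, hX.maximal, hX.isClosed, by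
    rw [hX.stratum_eq]
    exact Set.mem_singleton x⟩

/-- **`NearChainTerminationAt p e → TertiaryTerminationAt p e`.** [folklore] -/
theorem tertiaryTerminationAt_of_nearChainTerminationAt {e : ℕ} (h : NearChainTerminationAt.{u} p e) :
    TertiaryTerminationAt.{u} p e :=
  fun R hRf hRa N ν X _ x hX => h R hRf hRa N ν X x hX.isMaximalOrigin

/-- **`NearChainTermination p → TertiaryTermination p`.** [folklore] -/
theorem tertiaryTermination_of_nearChainTermination (h : NearChainTermination.{u} p) : TertiaryTermination.{u} p :=
  fun R hRf hRa N ν X _ x hX => h R hRf hRa N ν X x hX.isMaximalOrigin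

/-- The ungraded statement implies every graded one. [folklore] -/
theorem nearChainTerminationAt_of_nearChainTermination (h : NearChainTermination.{u} p) (e : ℕ) :
    NearChainTerminationAt.{u} p e :=
  fun R hRf hRa N ν X _ x hX => (h R hRf hRa N ν X x hX).mono fun _ _ => trivial

/-! ## `ν`-modifications from `NearChainTermination p` -/

/-- **`NearChainTermination p` + the oracle's answers on the strata ⇒ `ν`-MODIFICATION OF EVERY MAXIMAL STRATUM in
characteristic `p`, any dimension**: `X` reduced, separated, of finite type over a field of characteristic `p`,
`dim X ≤ N`, `dim X ≤ d`, `ν ≠ Φ^{(N)}` maximal; `R` functional admissible answering on the reduced closed non-empty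
subsets of the `ν`-strata met along `S(X, ν)`. [cite: CossartJannsenSaito2020, Def. 6.14, Rem. 6.29 (1), p. 107] -/
theorem nuMod_of_nearChainTermination {p : ℕ} (h : NearChainTermination.{0} p)
    {R : ∀ S : Scheme.{0}, CentreSeq S → Prop} {N : ℕ} {ν : ℕ → ℕ} (hRf : OracleFunctional R)
    (hRa : OracleAdmissible R) {k : Type} [Field k] [CharP k p] {X : Scheme.{0}} [IsLocallyNoetherian X]
    (f : X ⟶ Spec (.of k)) [IsSeparated f] [LocallyOfFiniteType f] [QuasiCompact f] [IsReduced X]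
    (hdimN : topologicalKrullDim X ≤ (N : WithBot ℕ∞)) {d : ℕ} (hdimd : topologicalKrullDim X ≤ (d : WithBot ℕ∞))
    (hmax : Maximal (· ∈ Scheme.hsValues X N) ν) (hν : ν ≠ iterPSum N Phi)
    (htotal : ∀ s : CentreSeq X, s.IsCanonicalRun R N ν → ∀ (Z : Set s.top) (hZ : IsClosed Z),
      Z ⊆ Scheme.hsStratum s.top N ν → Z.Nonempty →
        ∃ t, R (Scheme.IdealSheafData.vanishingIdeal ⟨Z, hZ⟩).subscheme t) :
    TameWild.NuMod X N d ν :=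
  nuMod_of_forall_noNearChain hRf hRa f hdimN hdimd hmax hν htotal fun x hx hxcl =>
    h R hRf hRa N ν X x ⟨⟨k, ‹_›, ‹_›, f, ‹_›, ‹_›, ‹_›⟩, ‹_›, hdimN, hmax, hxcl, hx⟩

/-- **Dimension `≤ 3`: `NearChainTermination p` + CJS Thm. 1.2 ⇒ `ν`-modification of every maximal stratum** of a
reduced separated `Y` of finite type over a field of characteristic `p` with `dim Y ≤ 3` (the answers come from the
printed resolution of excellent surfaces through the choice oracle). [cite: CossartJannsenSaito2020, Thm. 1.2, Def. 6.14, Rem. 6.29 (1)] -/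
theorem nuMod_threefold_of_nearChainTermination {p : ℕ} (h : NearChainTermination.{0} p)
    (hCJS : CossartJannsenSaito2020SequencePermissible.{0}) {N : ℕ} {ν : ℕ → ℕ} {k : Type} [Field k] [CharP k p]
    {Y : Scheme.{0}} [IsLocallyNoetherian Y] (g : Y ⟶ Spec (.of k)) [IsSeparated g] [LocallyOfFiniteType g]
    [QuasiCompact g] [IsReduced Y] (hdim3 : topologicalKrullDim Y ≤ ((3 : ℕ) : WithBot ℕ∞))
    (hdimN : topologicalKrullDim Y ≤ (N : WithBot ℕ∞)) {d : ℕ} (hdimd : topologicalKrullDim Y ≤ (d : WithBot ℕ∞))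
    (hmax : Maximal (· ∈ Scheme.hsValues Y N) ν) (hν : ν ≠ iterPSum N Phi) : TameWild.NuMod Y N d ν := by
  obtain ⟨R, hRf, hRa, hRtot⟩ := exists_choiceOracle.{0}
  exact nuMod_threefold_of_forall_noNearChain hCJS hRf hRa hRtot g hdim3 hdimN hdimd hmax hν fun y hy hycl =>
    h R hRf hRa N ν Y y ⟨⟨k, ‹_›, ‹_›, g, ‹_›, ‹_›, ‹_›⟩, ‹_›, hdimN, hmax, hycl, hy⟩

/-! ## The crux `SigmaMaxModificationsCorridor3` from `NearChainTermination` at all primes and CJS Thm. 1.2 -/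

/-- **`(∀ p prime, NearChainTermination p)` + CJS Thm. 1.2 ⇒ the crux body `B(X, N)` on `{dim ≤ 3}`** in every
positive characteristic: for `X` non-regular reduced separated of finite type over a field of characteristic `p > 0`,
`dim X ≤ 3`, `N ≥ dim X`. [cite: CossartJannsenSaito2020, Def. 6.15, Rem. 6.24, Thm. 1.2] -/
theorem hsBody_dim_le_three_of_nearChainTermination (hB : ∀ p : ℕ, p.Prime → NearChainTermination.{0} p)
    (hCJS : CossartJannsenSaito2020SequencePermissible.{0}) {p : ℕ} (hp : p.Prime) (k : Type) [Field k] [CharP k p]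
    (N : ℕ) (X : Scheme.{0}) (f : X ⟶ Spec (.of k)) (hsep : IsSeparated f) (hft : LocallyOfFiniteType f)
    (hqc : QuasiCompact f) (hred : IsReduced X) (hreg : ¬ Scheme.IsRegular X)
    (hd3 : topologicalKrullDim X ≤ ((3 : ℕ) : WithBot ℕ∞)) (hdN : topologicalKrullDim X ≤ (N : WithBot ℕ∞)) :
    TameWild.HSBody X N := by
  refine TameWild.hsBody_of_nuMods' k N 3 (fun Y g hsep' hft' hqc' hred' hY3 hYN ν hν hνΦ => ?_) X f hsep hft hqc
    hred hreg hd3 hdN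
  haveI := hsep'
  haveI := hft'
  haveI := hqc'
  haveI := hred'
  haveI : IsLocallyNoetherian Y := LocallyOfFiniteType.isLocallyNoetherian g
  exact nuMod_threefold_of_nearChainTermination (hB p hp) hCJS g hY3 hYN hY3 hν hνΦ

/-- **THE CRUX FROM THE TYPED OPEN ITEM: `(∀ p prime, NearChainTermination p)` and CJS Thm. 1.2 imply
`SigmaMaxModificationsCorridor3`** (stmt-ResolutionOfSingularities-19249), by name through the landed `rfl`-bridge.
Conditional — credits nothing; its two hypotheses are the OURS open item and the undischarged printed fact.
[cite: CossartJannsenSaito2020, Def. 6.15, Rem. 6.29 (1), Thm. 1.2, p. 107] -/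
theorem sigmaMaxModificationsCorridor3_of_nearChainTermination (hB : ∀ p : ℕ, p.Prime → NearChainTermination.{0} p)
    (hCJS : CossartJannsenSaito2020SequencePermissible.{0}) : SigmaMaxModificationsCorridor3 := by
  rw [TameWild.sigmaMaxModificationsCorridor3_iff]
  intro p hp k _ _ X f hsep hft hqc hred hreg _ hd3 N hdN _
  exact hsBody_dim_le_three_of_nearChainTermination hB hCJS hp k N X f hsep hft hqc hred hreg hd3 hdN

/-! ## Assembly over the grades at arbitrary maximal strata (appended 2026-08-27, same seat) -/

/-- **ASSEMBLY OVER THE GRADES, arbitrary maximal strata**: if `ē` does not increase along canonical near steps from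
stages reached from maximal origins of characteristic `p` (CJS Thm. 3.10 (4) for the — permissible, Cycles file —
canonical centres; an inline hypothesis here, the arbitrary-stratum analogue of `GeomDirDimNonincrease p`), then the
graded statements `NearChainTerminationAt p e` for all `e` give `NearChainTermination p`: along an infinite chain `ē` is
eventually constant, and the tail is an infinite chain inside one grade from the same origin.
[cite: CossartJannsenSaito2020, Thm. 3.10 (4), Rem. 6.29 (1)] -/
theorem nearChainTermination_of_forall
    (hmono : ∀ (R : ∀ S : Scheme.{u}, CentreSeq S → Prop), OracleFunctional R → OracleAdmissible R →
      ∀ (N : ℕ) (ν : ℕ → ℕ) (s s' : MarkedStage.{u}),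
        (∃ (X : Scheme.{u}) (h : IsLocallyNoetherian X) (x : X),
          IsMaximalOrigin p N ν X x ∧ Reaches R N ν (@MarkedStage.init X h x) s) →
        CanonicalNearStep R N ν s s' → s'.geomDirDim ≤ s.geomDirDim)
    (h : ∀ e, NearChainTerminationAt.{u} p e) : NearChainTermination.{u} p := by
  intro R hRf hRa N ν X _ x hX
  rintro ⟨c, h0, hstep, -⟩
  have hreach : ∀ n, Reaches R N ν (MarkedStage.init X x) (c n) := reaches_chain h0 hstep
  have hg : ∀ n, (c (n + 1)).geomDirDim ≤ (c n).geomDirDim := fun n =>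
    hmono R hRf hRa N ν (c n) (c (n + 1)) ⟨X, inferInstance, x, hX, hreach n⟩ (hstep n)
  obtain ⟨n₀, hn₀⟩ := eventually_const_of_succ_le (g := fun n => (c n).geomDirDim) hg
  refine h (c n₀).geomDirDim R hRf hRa N ν X x hX ⟨fun n => c (n₀ + n), hreach n₀, fun n => hstep (n₀ + n), ?_⟩
  intro n
  exact hn₀ n

end CampaignW42

end Summit.ResolutionOfSingularities.ResolutionOfSingularities.Theorems

end
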